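import Mathlib
import HarnessLib

/-!
# Route `KLProgramme` — crux K3 ENGINE (stmt-…-20437) stub (b) conj. 2 «(c-D)² FAMILY TELESCOPE», brick (D5-prep 2): the increment pair's RELATIVE jets in the
# TWO-SCALE CLASS — `ρ_k ≤ η^k·R_k(x)` with `R_k` a polynomial of degree `k` in the depth `x = 4^m`, explicit coefficients

Cell `gate-hubbard-kl`, seat hubbard-kl-k3c3-p2 (g10); F1-DESIGN §8/§10.  Input: the relative sizes `ρ₁, ρ₂, ρ₃` of `incrPair_B_rel_le` (`𝔅_k ≤ 𝔅₀ρ_k`), in one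
lattice direction of step norm `η`, with the line data of the increment pair in the two-scale class of a flow piece at depth `x ≥ 1`:
band `Λ ≤ E₀ ≤ 2Λ`, `E₁ = tη`, `E₂ = ε₂η²`, `E₃ = (ε₃₀ + ε₃₁x)η³` (the frame's third derivative grows linearly in `x`); piece `P₀ = G₀/x²`, `P₁ = (G₁/x)η`,
`P₂ = G₂η²`, `P₃ = G₃xη³`; profile ratio `κ = e₀²/Λ²`.  Output: `ρ_k ≤ η^k R_k(x)` with `R₁ = r₁₀ + r₁₁x`, `R₂ = r₂₀ + r₂₁x + r₂₂x²`,
`R₃ = r₃₀ + r₃₁x + r₃₂x² + r₃₃x³` and the coefficients displayed in the statement (`r_kk = 2G_k/G₀`: the top growth is the piece's own jet ratio) — the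
`ha_k` hypotheses of `famIncr_rate_three_le` / `famIncr_rate_two_le` (D3).

* `incrPair_lineData_twoScale_le` — level 1: `D_k ≤ d_kη^k`, `W_k ≤ w_kη^k` (`w₃` x-linear), `ω_k ≤ η^k o_k(x)`;
* **`incrPair_relJets_scale_le`** — level 2 (abstract monotonicity): `ρ_k ≤ η^k·ρ_k(d, w, o)`; substituting level 1 and regrouping in `x` (`ring`) gives
  `R₁ = κ(d₁+w₁) + o₁₀ + o₁₁x`, `R₂ = κ²(d₁+w₁)² + κ(o₁₀+o₁₁x)(2d₁+w₁) + κ(d₂+w₂) + o₂(x)`, `R₃` likewise (degree 3, top `2G₃/G₀`).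

Pure real algebra; no definitions, no sorry.  Nothing asserts superconductivity. [cite: BenfattoGiulianiMastropietro2006, §3 (3.2)–(3.8)]
-/

noncomputable section

namespace Summit.HubbardSuperconductivity.HubbardSuperconductivity.Theorems.TorusFourierL2

set_option linter.dupNamespace false -- summit = problem name (single-conjunct summit), D-0017

section TwoScale

variable {Λ E₀ t ε₂ ε₃₀ ε₃₁ G₀ G₁ G₂ G₃ η x E₁ E₂ E₃ P₀ P₁ P₂ P₃ D₁ D₂ D₃ W₀ W₁ W₂ W₃ ω₁ ω₂ ω₃ : ℝ}
  (hΛ : 0 < Λ) (hE₀l : Λ ≤ E₀) (hE₀u : E₀ ≤ 2 * Λ) (ht : 0 ≤ t) (hε₂ : 0 ≤ ε₂) (hε₃₀ : 0 ≤ ε₃₀) (hε₃₁ : 0 ≤ ε₃₁)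
  (hG₀ : 0 < G₀) (hG₁ : 0 ≤ G₁) (hG₂ : 0 ≤ G₂) (hG₃ : 0 ≤ G₃) (hη : 0 ≤ η) (hx : 1 ≤ x)
  (hE₁ : E₁ = t * η) (hE₂ : E₂ = ε₂ * η ^ 2) (hE₃ : E₃ = (ε₃₀ + ε₃₁ * x) * η ^ 3)
  (hP₀ : P₀ = G₀ / x ^ 2) (hP₁ : P₁ = G₁ / x * η) (hP₂ : P₂ = G₂ * η ^ 2) (hP₃ : P₃ = G₃ * x * η ^ 3)
  (hD₁ : D₁ = 2 * E₀ * E₁) (hD₂ : D₂ = 2 * (E₁ ^ 2 + E₀ * E₂)) (hD₃ : D₃ = 2 * (3 * E₁ * E₂ + E₀ * E₃))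
  (hW₀ : W₀ = P₀ * (2 * E₀ + P₀)) (hW₁ : W₁ = 2 * (E₁ * P₀ + E₀ * P₁ + P₀ * P₁))
  (hW₂ : W₂ = 2 * (E₂ * P₀ + 2 * E₁ * P₁ + E₀ * P₂ + P₁ ^ 2 + P₀ * P₂))
  (hW₃ : W₃ = 2 * (E₃ * P₀ + 3 * E₂ * P₁ + 3 * E₁ * P₂ + E₀ * P₃ + 3 * P₁ * P₂ + P₀ * P₃))
  (hω₁ : ω₁ = E₁ / E₀ + 2 * P₁ / P₀) (hω₂ : ω₂ = E₂ / E₀ + 2 * E₁ * P₁ / (E₀ * P₀) + 2 * P₂ / P₀ + P₁ ^ 2 / (E₀ * P₀))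
  (hω₃ : ω₃ = E₃ / E₀ + 3 * E₂ * P₁ / (E₀ * P₀) + 3 * E₁ * P₂ / (E₀ * P₀) + 2 * P₃ / P₀ + 3 * P₁ * P₂ / (E₀ * P₀))

include hΛ hE₀l hE₀u ht hε₂ hε₃₀ hε₃₁ hG₀ hG₁ hG₂ hG₃ hη hx hE₁ hE₂ hE₃ hP₀ hP₁ hP₂ hP₃ hD₁ hD₂ hD₃ hW₁ hW₂ hW₃ hω₁ hω₂ hω₃ in
set_option maxHeartbeats 800000 in
/-- **Level 1: the line data of the increment pair in the two-scale class** — `D₁ ≤ 4Λt·η`, `W₁ ≤ 2(tG₀ + 2ΛG₁ + G₀G₁)·η`, `D₂ ≤ 2(t² + 2Λε₂)η²`,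
`W₂ ≤ 2(ε₂G₀ + 2tG₁ + 2ΛG₂ + G₁² + G₀G₂)η²`, `D₃ ≤ (2(3tε₂ + 2Λε₃₀) + 4Λε₃₁x)η³`, `W₃ ≤ (2(ε₃₀G₀ + ε₃₁G₀ + 3ε₂G₁ + 3tG₂ + 3G₁G₂ + G₀G₃) + 4ΛG₃x)η³`,
`ω₁ ≤ η(t/Λ + (2G₁/G₀)x)`, `ω₂ ≤ η²((ε₂/Λ + G₁²/(ΛG₀)) + (2tG₁/(ΛG₀))x + (2G₂/G₀)x²)`,
`ω₃ ≤ η³(ε₃₀/Λ + (ε₃₁/Λ + 3ε₂G₁/(ΛG₀) + 3G₁G₂/(ΛG₀))x + (3tG₂/(ΛG₀))x² + (2G₃/G₀)x³)`. [cite: BenfattoGiulianiMastropietro2006, §3 (3.2)] -/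
theorem incrPair_lineData_twoScale_le :
    D₁ ≤ 4 * Λ * t * η ∧ W₁ ≤ 2 * (t * G₀ + 2 * Λ * G₁ + G₀ * G₁) * η ∧
    D₂ ≤ 2 * (t ^ 2 + 2 * Λ * ε₂) * η ^ 2 ∧ W₂ ≤ 2 * (ε₂ * G₀ + 2 * t * G₁ + 2 * Λ * G₂ + G₁ ^ 2 + G₀ * G₂) * η ^ 2 ∧
    D₃ ≤ (2 * (3 * t * ε₂ + 2 * Λ * ε₃₀) + 4 * Λ * ε₃₁ * x) * η ^ 3 ∧
    W₃ ≤ (2 * (ε₃₀ * G₀ + ε₃₁ * G₀ + 3 * ε₂ * G₁ + 3 * t * G₂ + 3 * G₁ * G₂ + G₀ * G₃) + 4 * Λ * G₃ * x) * η ^ 3 ∧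
    ω₁ ≤ η * (t / Λ + 2 * G₁ / G₀ * x) ∧
    ω₂ ≤ η ^ 2 * ((ε₂ / Λ + G₁ ^ 2 / (Λ * G₀)) + 2 * t * G₁ / (Λ * G₀) * x + 2 * G₂ / G₀ * x ^ 2) ∧
    ω₃ ≤ η ^ 3 * (ε₃₀ / Λ + (ε₃₁ / Λ + 3 * ε₂ * G₁ / (Λ * G₀) + 3 * G₁ * G₂ / (Λ * G₀)) * x + 3 * t * G₂ / (Λ * G₀) * x ^ 2 +
      2 * G₃ / G₀ * x ^ 3) := by
  have hx0 : 0 < x := lt_of_lt_of_le one_pos hx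
  have hE0 : 0 < E₀ := lt_of_lt_of_le hΛ hE₀l
  have hx1 : 1 ≤ x ^ 2 := one_le_pow₀ hx
  have hix : 1 / x ≤ 1 := by rw [div_le_one hx0]; exact hx
  have hix2 : 1 / x ^ 2 ≤ 1 := by rw [div_le_one (by positivity)]; exact hx1
  -- the substituted data, with the `x`-negative powers isolated
  have eP₀ : P₀ = G₀ * (1 / x ^ 2) := by rw [hP₀]; ring
  have eP₁ : P₁ = G₁ * η * (1 / x) := by rw [hP₁]; field_simp
  have hP0 : 0 ≤ P₀ := by rw [hP₀]; positivity
  have hP1 : 0 ≤ P₁ := by rw [hP₁]; positivity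
  have hP2 : 0 ≤ P₂ := by rw [hP₂]; positivity
  have hP3 : 0 ≤ P₃ := by rw [hP₃]; positivity
  have bP₀ : P₀ ≤ G₀ := by rw [eP₀]; exact (mul_le_mul_of_nonneg_left hix2 hG₀.le).trans (le_of_eq (mul_one _))
  have bP₁ : P₁ ≤ G₁ * η := by rw [eP₁]; exact (mul_le_mul_of_nonneg_left hix (by positivity)).trans (le_of_eq (mul_one _))
  have hE1 : 0 ≤ E₁ := by rw [hE₁]; positivity
  have hE2 : 0 ≤ E₂ := by rw [hE₂]; positivity
  have hE3 : 0 ≤ E₃ := by rw [hE₃]; positivity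
  refine ⟨?_, ?_, ?_, ?_, ?_, ?_, ?_, ?_, ?_⟩
  · -- D₁
    rw [hD₁, hE₁]; linarith only [mul_le_mul_of_nonneg_right hE₀u (mul_nonneg ht hη)]
  · -- W₁
    rw [hW₁]
    have t1 : E₁ * P₀ ≤ t * η * G₀ := by rw [hE₁]; exact mul_le_mul_of_nonneg_left bP₀ (by positivity)
    have t2 : E₀ * P₁ ≤ 2 * Λ * (G₁ * η) := mul_le_mul hE₀u bP₁ hP1 (by positivity)
    have t3 : P₀ * P₁ ≤ G₀ * (G₁ * η) := mul_le_mul bP₀ bP₁ hP1 hG₀.le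
    linarith only [t1, t2, t3]
  · -- D₂
    rw [hD₂, hE₁, hE₂]
    have : E₀ * (ε₂ * η ^ 2) ≤ 2 * Λ * (ε₂ * η ^ 2) := mul_le_mul_of_nonneg_right hE₀u (by positivity)
    linarith only [this]
  · -- W₂
    rw [hW₂]
    have t1 : E₂ * P₀ ≤ ε₂ * η ^ 2 * G₀ := by rw [hE₂]; exact mul_le_mul_of_nonneg_left bP₀ (by positivity)
    have t2 : E₁ * P₁ ≤ t * η * (G₁ * η) := by rw [hE₁]; exact mul_le_mul_of_nonneg_left bP₁ (by positivity)
    have t3 : E₀ * P₂ ≤ 2 * Λ * (G₂ * η ^ 2) := by rw [hP₂]; exact mul_le_mul_of_nonneg_right hE₀u (by positivity)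
    have t4 : P₁ ^ 2 ≤ (G₁ * η) ^ 2 := pow_le_pow_left₀ hP1 bP₁ 2
    have t5 : P₀ * P₂ ≤ G₀ * (G₂ * η ^ 2) := by rw [hP₂]; exact mul_le_mul_of_nonneg_right bP₀ (by positivity)
    linarith only [t1, t2, t3, t4, t5]
  · -- D₃
    rw [hD₃, hE₁, hE₂, hE₃]
    have : E₀ * ((ε₃₀ + ε₃₁ * x) * η ^ 3) ≤ 2 * Λ * ((ε₃₀ + ε₃₁ * x) * η ^ 3) := mul_le_mul_of_nonneg_right hE₀u (by positivity)
    linarith only [this]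
  · -- W₃
    rw [hW₃]
    have hxP : (ε₃₀ + ε₃₁ * x) * P₀ ≤ (ε₃₀ + ε₃₁) * G₀ := by
      -- `(ε₃₀ + ε₃₁x)·G₀/x² ≤ (ε₃₀ + ε₃₁)G₀` since `x/x² ≤ 1` and `1/x² ≤ 1`
      rw [hP₀]
      have hG0x : G₀ / x ^ 2 ≤ G₀ := by have h := bP₀; rw [hP₀] at h; exact h
      have h1 : ε₃₀ * (G₀ / x ^ 2) ≤ ε₃₀ * G₀ := mul_le_mul_of_nonneg_left hG0x hε₃₀
      have h2 : ε₃₁ * x * (G₀ / x ^ 2) ≤ ε₃₁ * G₀ := by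
        have e : ε₃₁ * x * (G₀ / x ^ 2) = ε₃₁ * G₀ * (1 / x) := by field_simp
        rw [e]; exact (mul_le_mul_of_nonneg_left hix (by positivity)).trans (le_of_eq (mul_one _))
      linarith only [h1, h2]
    have t1 : E₃ * P₀ ≤ (ε₃₀ + ε₃₁) * G₀ * η ^ 3 := by
      rw [hE₃, show (ε₃₀ + ε₃₁ * x) * η ^ 3 * P₀ = ((ε₃₀ + ε₃₁ * x) * P₀) * η ^ 3 by ring]
      exact mul_le_mul_of_nonneg_right hxP (by positivity)
    have t2 : E₂ * P₁ ≤ ε₂ * η ^ 2 * (G₁ * η) := by rw [hE₂]; exact mul_le_mul_of_nonneg_left bP₁ (by positivity)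
    have t3 : E₁ * P₂ = t * η * (G₂ * η ^ 2) := by rw [hE₁, hP₂]
    have t4 : E₀ * P₃ ≤ 2 * Λ * (G₃ * x * η ^ 3) := by rw [hP₃]; exact mul_le_mul_of_nonneg_right hE₀u (by positivity)
    have t5 : P₁ * P₂ ≤ G₁ * η * (G₂ * η ^ 2) := by rw [hP₂]; exact mul_le_mul_of_nonneg_right bP₁ (by positivity)
    have t6 : P₀ * P₃ ≤ G₀ * G₃ * η ^ 3 := by
      rw [hP₀, hP₃]
      have e : G₀ / x ^ 2 * (G₃ * x * η ^ 3) = G₀ * G₃ * η ^ 3 * (1 / x) := by field_simp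
      rw [e]; exact (mul_le_mul_of_nonneg_left hix (by positivity)).trans (le_of_eq (mul_one _))
    linarith only [t1, t2, t3, t4, t5, t6]
  · -- ω₁
    rw [hω₁, hE₁, hP₁, hP₀]
    have t1 : t * η / E₀ ≤ t * η / Λ := div_le_div_of_nonneg_left (by positivity) hΛ hE₀l
    have t2 : 2 * (G₁ / x * η) / (G₀ / x ^ 2) = η * (2 * G₁ / G₀ * x) := by field_simp
    rw [t2]
    have e1 : t * η / Λ = η * (t / Λ) := by ring
    linarith only [t1, e1]
  · -- ω₂
    rw [hω₂, hE₁, hE₂, hP₁, hP₂, hP₀]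
    have t1 : ε₂ * η ^ 2 / E₀ ≤ ε₂ * η ^ 2 / Λ := div_le_div_of_nonneg_left (by positivity) hΛ hE₀l
    have t2 : 2 * (t * η) * (G₁ / x * η) / (E₀ * (G₀ / x ^ 2)) = (2 * t * G₁ * η ^ 2 * x / G₀) / E₀ := by field_simp
    have t2' : (2 * t * G₁ * η ^ 2 * x / G₀) / E₀ ≤ (2 * t * G₁ * η ^ 2 * x / G₀) / Λ := div_le_div_of_nonneg_left (by positivity) hΛ hE₀l
    have t3 : 2 * (G₂ * η ^ 2) / (G₀ / x ^ 2) = η ^ 2 * (2 * G₂ / G₀ * x ^ 2) := by field_simp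
    have t4 : (G₁ / x * η) ^ 2 / (E₀ * (G₀ / x ^ 2)) = (G₁ ^ 2 * η ^ 2 / G₀) / E₀ := by field_simp
    have t4' : (G₁ ^ 2 * η ^ 2 / G₀) / E₀ ≤ (G₁ ^ 2 * η ^ 2 / G₀) / Λ := div_le_div_of_nonneg_left (by positivity) hΛ hE₀l
    rw [t2, t3, t4]
    have e : η ^ 2 * ((ε₂ / Λ + G₁ ^ 2 / (Λ * G₀)) + 2 * t * G₁ / (Λ * G₀) * x + 2 * G₂ / G₀ * x ^ 2) =
        ε₂ * η ^ 2 / Λ + (2 * t * G₁ * η ^ 2 * x / G₀) / Λ + η ^ 2 * (2 * G₂ / G₀ * x ^ 2) + (G₁ ^ 2 * η ^ 2 / G₀) / Λ := by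
      field_simp; ring
    rw [e]; linarith only [t1, t2', t4']
  · -- ω₃
    rw [hω₃, hE₁, hE₂, hE₃, hP₁, hP₂, hP₃, hP₀]
    have t1 : (ε₃₀ + ε₃₁ * x) * η ^ 3 / E₀ ≤ (ε₃₀ + ε₃₁ * x) * η ^ 3 / Λ := div_le_div_of_nonneg_left (by positivity) hΛ hE₀l
    have t2 : 3 * (ε₂ * η ^ 2) * (G₁ / x * η) / (E₀ * (G₀ / x ^ 2)) = (3 * ε₂ * G₁ * η ^ 3 * x / G₀) / E₀ := by field_simp
    have t2' : (3 * ε₂ * G₁ * η ^ 3 * x / G₀) / E₀ ≤ (3 * ε₂ * G₁ * η ^ 3 * x / G₀) / Λ := div_le_div_of_nonneg_left (by positivity) hΛ hE₀l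
    have t3 : 3 * (t * η) * (G₂ * η ^ 2) / (E₀ * (G₀ / x ^ 2)) = (3 * t * G₂ * η ^ 3 * x ^ 2 / G₀) / E₀ := by field_simp
    have t3' : (3 * t * G₂ * η ^ 3 * x ^ 2 / G₀) / E₀ ≤ (3 * t * G₂ * η ^ 3 * x ^ 2 / G₀) / Λ := div_le_div_of_nonneg_left (by positivity) hΛ hE₀l
    have t4 : 2 * (G₃ * x * η ^ 3) / (G₀ / x ^ 2) = η ^ 3 * (2 * G₃ / G₀ * x ^ 3) := by field_simp
    have t5 : 3 * (G₁ / x * η) * (G₂ * η ^ 2) / (E₀ * (G₀ / x ^ 2)) = (3 * G₁ * G₂ * η ^ 3 * x / G₀) / E₀ := by field_simp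
    have t5' : (3 * G₁ * G₂ * η ^ 3 * x / G₀) / E₀ ≤ (3 * G₁ * G₂ * η ^ 3 * x / G₀) / Λ := div_le_div_of_nonneg_left (by positivity) hΛ hE₀l
    rw [t2, t3, t4, t5]
    have e : η ^ 3 * (ε₃₀ / Λ + (ε₃₁ / Λ + 3 * ε₂ * G₁ / (Λ * G₀) + 3 * G₁ * G₂ / (Λ * G₀)) * x + 3 * t * G₂ / (Λ * G₀) * x ^ 2 + 2 * G₃ / G₀ * x ^ 3) =
        (ε₃₀ + ε₃₁ * x) * η ^ 3 / Λ + (3 * ε₂ * G₁ * η ^ 3 * x / G₀) / Λ + (3 * t * G₂ * η ^ 3 * x ^ 2 / G₀) / Λ + η ^ 3 * (2 * G₃ / G₀ * x ^ 3) +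
          (3 * G₁ * G₂ * η ^ 3 * x / G₀) / Λ := by
      field_simp; ring
    rw [e]; linarith only [t1, t2', t3', t5']

/-- **Level 2 (abstract monotonicity)**: the relative sizes `ρ₁, ρ₂, ρ₃` of `incrPair_B_rel_le` are increasing in `D_k, W_k, ω_k ≥ 0`; with scale-form bounds
`D_k ≤ d_kη^k`, `W_k ≤ w_kη^k`, `ω_k ≤ o_kη^k` they are `≤ η^k ×` the same expressions in `d, w, o` (regroup in `x` afterwards with `ring`).
[cite: BenfattoGiulianiMastropietro2006, §3 (3.2)–(3.8)] -/
theorem incrPair_relJets_scale_le {κ η D₁ D₂ D₃ W₁ W₂ W₃ ω₁ ω₂ ω₃ d₁ d₂ d₃ w₁ w₂ w₃ o₁ o₂ o₃ : ℝ} (hκ : 0 ≤ κ)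
    (hD₁ : 0 ≤ D₁) (hD₂ : 0 ≤ D₂) (hW₁ : 0 ≤ W₁) (hW₂ : 0 ≤ W₂) (hω₁ : 0 ≤ ω₁) (hω₂ : 0 ≤ ω₂)
    (bD₁ : D₁ ≤ d₁ * η) (bD₂ : D₂ ≤ d₂ * η ^ 2) (bD₃ : D₃ ≤ d₃ * η ^ 3) (bW₁ : W₁ ≤ w₁ * η) (bW₂ : W₂ ≤ w₂ * η ^ 2) (bW₃ : W₃ ≤ w₃ * η ^ 3)
    (bω₁ : ω₁ ≤ o₁ * η) (bω₂ : ω₂ ≤ o₂ * η ^ 2) (bω₃ : ω₃ ≤ o₃ * η ^ 3) :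
    κ * (D₁ + W₁) + ω₁ ≤ η * (κ * (d₁ + w₁) + o₁) ∧
    κ ^ 2 * (D₁ + W₁) ^ 2 + κ * (ω₁ * (2 * D₁ + W₁)) + κ * (D₂ + W₂) + ω₂ ≤
      η ^ 2 * (κ ^ 2 * (d₁ + w₁) ^ 2 + κ * (o₁ * (2 * d₁ + w₁)) + κ * (d₂ + w₂) + o₂) ∧
    κ ^ 3 * (D₁ + W₁) ^ 3 + κ ^ 2 * (ω₁ * (3 * D₁ ^ 2 + 3 * D₁ * W₁ + W₁ ^ 2)) +
        3 * (κ ^ 2 * ((D₁ + W₁) * (D₂ + W₂)) + κ * (D₁ * ω₂ + ω₁ * D₂ + ω₁ * W₂)) + κ * (D₃ + W₃) + ω₃ ≤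
      η ^ 3 * (κ ^ 3 * (d₁ + w₁) ^ 3 + κ ^ 2 * (o₁ * (3 * d₁ ^ 2 + 3 * d₁ * w₁ + w₁ ^ 2)) +
        3 * (κ ^ 2 * ((d₁ + w₁) * (d₂ + w₂)) + κ * (d₁ * o₂ + o₁ * d₂ + o₁ * w₂)) + κ * (d₃ + w₃) + o₃) := by
  -- the scale-form data are nonnegative where needed
  have hd₁ : 0 ≤ d₁ * η := hD₁.trans bD₁
  have hw₁ : 0 ≤ w₁ * η := hW₁.trans bW₁
  have hd₂ : 0 ≤ d₂ * η ^ 2 := hD₂.trans bD₂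
  have hw₂ : 0 ≤ w₂ * η ^ 2 := hW₂.trans bW₂
  have ho₁ : 0 ≤ o₁ * η := hω₁.trans bω₁
  have ho₂ : 0 ≤ o₂ * η ^ 2 := hω₂.trans bω₂
  have s₁ : D₁ + W₁ ≤ (d₁ + w₁) * η := by linarith
  have s₁0 : 0 ≤ D₁ + W₁ := by positivity
  have s₂ : D₂ + W₂ ≤ (d₂ + w₂) * η ^ 2 := by linarith
  have s₂0 : 0 ≤ D₂ + W₂ := by positivity
  refine ⟨?_, ?_, ?_⟩
  · nlinarith [mul_le_mul_of_nonneg_left s₁ hκ]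
  · have p1 : (D₁ + W₁) ^ 2 ≤ ((d₁ + w₁) * η) ^ 2 := pow_le_pow_left₀ s₁0 s₁ 2
    have p2 : ω₁ * (2 * D₁ + W₁) ≤ (o₁ * η) * ((2 * d₁ + w₁) * η) := mul_le_mul bω₁ (by linarith) (by positivity) ho₁
    have e : η ^ 2 * (κ ^ 2 * (d₁ + w₁) ^ 2 + κ * (o₁ * (2 * d₁ + w₁)) + κ * (d₂ + w₂) + o₂) =
        κ ^ 2 * ((d₁ + w₁) * η) ^ 2 + κ * ((o₁ * η) * ((2 * d₁ + w₁) * η)) + κ * ((d₂ + w₂) * η ^ 2) + o₂ * η ^ 2 := by ring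
    rw [e]
    have hκ2 : 0 ≤ κ ^ 2 := by positivity
    nlinarith [mul_le_mul_of_nonneg_left p1 hκ2, mul_le_mul_of_nonneg_left p2 hκ, mul_le_mul_of_nonneg_left s₂ hκ, bω₂]
  · have p1 : (D₁ + W₁) ^ 3 ≤ ((d₁ + w₁) * η) ^ 3 := pow_le_pow_left₀ s₁0 s₁ 3
    have q0 : 3 * D₁ ^ 2 + 3 * D₁ * W₁ + W₁ ^ 2 ≤ (3 * d₁ ^ 2 + 3 * d₁ * w₁ + w₁ ^ 2) * η ^ 2 := by
      have a1 : D₁ ^ 2 ≤ (d₁ * η) ^ 2 := pow_le_pow_left₀ hD₁ bD₁ 2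
      have a2 : D₁ * W₁ ≤ (d₁ * η) * (w₁ * η) := mul_le_mul bD₁ bW₁ hW₁ hd₁
      have a3 : W₁ ^ 2 ≤ (w₁ * η) ^ 2 := pow_le_pow_left₀ hW₁ bW₁ 2
      nlinarith [a1, a2, a3]
    have p2 : ω₁ * (3 * D₁ ^ 2 + 3 * D₁ * W₁ + W₁ ^ 2) ≤ (o₁ * η) * ((3 * d₁ ^ 2 + 3 * d₁ * w₁ + w₁ ^ 2) * η ^ 2) :=
      mul_le_mul bω₁ q0 (by positivity) ho₁
    have p3 : (D₁ + W₁) * (D₂ + W₂) ≤ ((d₁ + w₁) * η) * ((d₂ + w₂) * η ^ 2) := mul_le_mul s₁ s₂ s₂0 (s₁0.trans s₁)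
    have p4 : D₁ * ω₂ ≤ (d₁ * η) * (o₂ * η ^ 2) := mul_le_mul bD₁ bω₂ hω₂ hd₁
    have p5 : ω₁ * D₂ ≤ (o₁ * η) * (d₂ * η ^ 2) := mul_le_mul bω₁ bD₂ hD₂ ho₁
    have p6 : ω₁ * W₂ ≤ (o₁ * η) * (w₂ * η ^ 2) := mul_le_mul bω₁ bW₂ hW₂ ho₁
    have p7 : D₃ + W₃ ≤ (d₃ + w₃) * η ^ 3 := by linarith
    have e : η ^ 3 * (κ ^ 3 * (d₁ + w₁) ^ 3 + κ ^ 2 * (o₁ * (3 * d₁ ^ 2 + 3 * d₁ * w₁ + w₁ ^ 2)) +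
        3 * (κ ^ 2 * ((d₁ + w₁) * (d₂ + w₂)) + κ * (d₁ * o₂ + o₁ * d₂ + o₁ * w₂)) + κ * (d₃ + w₃) + o₃) =
        κ ^ 3 * ((d₁ + w₁) * η) ^ 3 + κ ^ 2 * ((o₁ * η) * ((3 * d₁ ^ 2 + 3 * d₁ * w₁ + w₁ ^ 2) * η ^ 2)) +
        3 * (κ ^ 2 * (((d₁ + w₁) * η) * ((d₂ + w₂) * η ^ 2)) + κ * ((d₁ * η) * (o₂ * η ^ 2) + (o₁ * η) * (d₂ * η ^ 2) + (o₁ * η) * (w₂ * η ^ 2))) +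
        κ * ((d₃ + w₃) * η ^ 3) + o₃ * η ^ 3 := by ring
    rw [e]
    have hκ2 : 0 ≤ κ ^ 2 := by positivity
    have hκ3 : 0 ≤ κ ^ 3 := by positivity
    have u1 := mul_le_mul_of_nonneg_left p1 hκ3
    have u2 := mul_le_mul_of_nonneg_left p2 hκ2
    have u3 := mul_le_mul_of_nonneg_left p3 hκ2
    have u4 : κ * (D₁ * ω₂ + ω₁ * D₂ + ω₁ * W₂) ≤ κ * ((d₁ * η) * (o₂ * η ^ 2) + (o₁ * η) * (d₂ * η ^ 2) + (o₁ * η) * (w₂ * η ^ 2)) :=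
      mul_le_mul_of_nonneg_left (by linarith) hκ
    have u5 := mul_le_mul_of_nonneg_left p7 hκ
    linarith [u1, u2, u3, u4, u5, bω₃]

end TwoScale

end Summit.HubbardSuperconductivity.HubbardSuperconductivity.Theorems.TorusFourierL2

end
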